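import Literature.MathematicalPhysics.QuantumFieldTheory.Balaban1983to89.Beta.PolarizationSign

/-!
# `BalabanUV.Beta.D1BFx.WardDiagonalSecondMoment` — road «BF-x», binder row D1, RE-TABLE (an2 R-D1-g55-1 (2)), leaf-01's located
# control P3 ∕ design item D1 of COUNT v4 AS A THEOREM: **THE DIAGONAL SECOND MOMENT OF A WARD-TRANSVERSE KERNEL VANISHES**

For ANY lattice kernel `P : B12Beta.Kernel d` with the printed Ward identity (5.9) `Σ_μ ∂*_μ P_{μν} = 0` (`PolarizationSign.WardTransversal`)
and summable third moments (`MomentSummable P 3`), testing the identity against the one-axis polynomial weights `z ↦ z_β`, `z_β²`, `z_β³`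
(`PolarizationSign.ward_pairing`, the tree's summation by parts) gives, for every `β` and EVERY second index `ν`,
`Σ_z P_{βν}(z) = 0` (the tree's `tsum_eq_zero_of_ward`), `Σ_z P_{βν}(z)·z_β = 0` and `Σ_z P_{βν}(z)·z_β² = 0`; in particular the DIAGONAL entry of
(1.22), `B12Beta.secondMoment P β β = Σ_z P_{ββ}(z)·z_β·z_β`, is `0`, and the diagonal second moments of any TWO transverse kernels coincide.
§3: for an INDEX-SYMMETRIC transverse kernel ((5.8) `PolarizationSign.IndexSymmetric`) also `Σ_z P_{μν}(z)·z_ν² = 0`, hence the DIAGONAL-MOMENTUM form of (1.22):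
`Σ_z P_{μν}(z)·(z_μ + z_ν)² = 2·secondMoment P μ ν` — the dictionary between the CAP lane's estimator direction `p = ε(e_μ + e_ν)` and (1.22).
§4: the AXIS-SWAP LAW `P_{μν}(z) = P_{μν}(−(z ∘ swap μ ν))` of a permutation-covariant ((1.21)), index-symmetric ((5.8)) kernel — the one-channel identity behind the row's
by-value covariance test Q-an2-g55-1 (again a HYPOTHESIS-to-conclusion lemma: it says what the printed `Π` satisfies, not that any typed kernel does).

WHY (located, zero weight on rulings).  Under RE-TABLE the (J1) row's object is `X(n) = secondMoment(literal) − secondMoment(re-tabled road)`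
(F6 `ChartDefectTransportDefect.literal_sub_retabled_eq_transportDefect_words`).  Engine C's PRESTAB deposit shows `X^{(0,0)} = 4e−15 ∕ 8e−15 ∕ −2e−13`
at `(4,3)`, `p = 3∕4∕6`, while the hybrid road's `Δ_hyb^{(0,0)} = ±4e−4` (leaf-01 g36 COUNT v4 memo §2).  This file is the `ℤ^d` statement behind that
observation: BOTH consistent letters are Ward-transverse (the END's binder `hW` for the literal; an1's `wardTransversal_…` theorems for comb-pin letters),
hence both diagonal second moments are `0` — the «(0,0) control» of R-D1-g55-1 (3)(i) is a CONSISTENCY (Ward) control of the re-tabled road's assembled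
letter, channel by channel, at every blocking.  Nothing here says which kernels ARE transverse: `WardTransversal` enters as a HYPOTHESIS only.

HONEST DEPENDENCY (cell records, verbatim): «continuum YM on T⁴ ⇐ BetaPertH ∧ nine spine estimates (0/9 proved); BetaPertH ⇐ (D1) ∧ (D4) ∧
CAP+tail; G-an2-4 gates asym, D1 and NE2/3/4.»  HONEST FRAMING (cell contract, verbatim): «discharging `BetaPertH` makes Bałaban's UV stability
UNCONDITIONAL — a real constructive-QFT result; it is NOT the continuum limit and NOT the Clay problem.»  THIS MODULE DISCHARGES NOTHING of the wall:
[folklore] summation by parts on `ℤ^d` with the tree's `ward_pairing` BY NAME; no definition, no `def … : Prop`, nothing cited as a fact (the docstring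
locators point at the printed identities the HYPOTHESES transcribe), 0 sorry, default heartbeats.  0∕4 row-D1 binders; (J1) ONE OPEN ROW; NOT D1,
NEVER «G-an2-4 closed», NOT `BetaPertH`, NOT continuum, NOT Clay.

ABSOLUTE RULE (cell charter, verbatim): «No internally-minted statement may enter as a cited fact. Every hypothesis is either kernel-proved in this
package or a verbatim quotation of a PUBLISHED theorem with page reference. The manuscript(s) under audit are NOT citable for their own disputed
steps — they are the thing under adjudication; programme-internal (2001/route/tribunal) claims are never citable.»

Unit `b2b-balaban-beta-d1-formalise-leaf-01` (gen 36), 2026-08-24; no existing file touched.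
-/

namespace Summit.QuantumFields.BalabanUV.Beta.D1BFx.WardDiagonalSecondMoment

open Literature.MathematicalPhysics.QuantumFieldTheory.Balaban1983to89
open Literature.MathematicalPhysics.QuantumFieldTheory.Balaban1983to89.Beta.PolarizationSign
  (size size_pos one_le_size abs_apply_le_size size_le_pow size_add_unitVec_le WardTransversal IndexSymmetric MomentSummable
   ward_pairing tsum_eq_zero_of_ward)
open Literature.MathematicalPhysics.QuantumFieldTheory.Balaban1983to89.B6BondElimination (unitVec unitVec_apply)

attribute [local simp] Literature.MathematicalPhysics.QuantumFieldTheory.Balaban1983to89.B6BondElimination.unitVec_apply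

variable {d : ℕ}

/-! ## §1 Summability of the one-axis polynomial weights against a kernel with summable third moments -/

/-- [folklore] `|z_β|^k ≤ size z ^ 3` for `k ≤ 3`. -/
theorem abs_pow_le_size_cube (z : Fin d → ℤ) (β : Fin d) {k : ℕ} (hk : k ≤ 3) : |(z β : ℝ)| ^ k ≤ size z ^ 3 :=
  calc |(z β : ℝ)| ^ k ≤ size z ^ k := pow_le_pow_left₀ (abs_nonneg _) (abs_apply_le_size z β) k
    _ ≤ size z ^ 3 := pow_le_pow_right₀ (one_le_size z) hk

/-- [folklore] `Σ_z P_{μν}(z)·z_β^k` converges absolutely for `k ≤ 3`. -/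
theorem momentSummable_mul_pow {P : B12Beta.Kernel d} (hP : MomentSummable P 3) (μ ν β : Fin d) {k : ℕ} (hk : k ≤ 3) :
    Summable fun z => P μ ν z * (z β : ℝ) ^ k :=
  hP.summable_mul μ ν 1 fun z => by
    rw [abs_pow, one_mul]; exact abs_pow_le_size_cube z β hk

/-- [folklore] The shifted weights `z ↦ ((z + e_γ)_β)^k` also pair summably (`size (z + e_γ) ≤ 2·size z`). -/
theorem momentSummable_mul_pow_shift {P : B12Beta.Kernel d} (hP : MomentSummable P 3) (μ ν β γ : Fin d) {k : ℕ} (hk : k ≤ 3) :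
    Summable fun z => P μ ν z * (((z + unitVec γ) β : ℤ) : ℝ) ^ k :=
  hP.summable_mul μ ν 8 fun z => by
    rw [abs_pow]
    calc |(((z + unitVec γ) β : ℤ) : ℝ)| ^ k ≤ size (z + unitVec γ) ^ 3 := abs_pow_le_size_cube _ β hk
      _ ≤ (2 * size z) ^ 3 := by
          gcongr
          · exact (size_pos _).le
          · exact size_add_unitVec_le z γ
      _ = 8 * size z ^ 3 := by ring

/-- [folklore] The shift of the `β`-coordinate by `e_μ`, as a real number: `(z + e_μ)_β = z_β + [μ = β]`. -/
theorem cast_add_unitVec_apply (z : Fin d → ℤ) (μ β : Fin d) :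
    (((z + unitVec μ) β : ℤ) : ℝ) = (z β : ℝ) + if μ = β then 1 else 0 := by
  simp only [Pi.add_apply, unitVec_apply, Int.cast_add]
  by_cases h : β = μ
  · subst h; simp
  · simp [h, Ne.symm h]

/-! ## §2 The one-axis moments of a transverse kernel: `Σ P_{βν} z_β = 0`, `Σ P_{βν} z_β² = 0`, hence `secondMoment P β β = 0` -/

/-- [folklore] **FIRST ONE-AXIS MOMENT.**  Ward (5.9) tested against `g(z) = z_β²` (`(z_β+1)² − z_β² = 2z_β + 1`) together with the vanishing
zeroth moment gives `Σ_z P_{βν}(z)·z_β = 0` for every `ν` (no reflection covariance needed). -/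
theorem firstMoment_self_eq_zero_of_ward {P : B12Beta.Kernel d} (hP : MomentSummable P 3) (hT : WardTransversal P) (β ν : Fin d) :
    ∑' z, P β ν z * (z β : ℝ) = 0 := by
  have key := ward_pairing P hT ν (fun z => (z β : ℝ) ^ 2) (fun μ => momentSummable_mul_pow hP μ ν β (by norm_num))
    (fun μ => momentSummable_mul_pow_shift hP μ ν β μ (by norm_num))
  have hdiff : ∀ μ z, (((z + unitVec μ) β : ℤ) : ℝ) ^ 2 - (z β : ℝ) ^ 2 = if μ = β then 2 * (z β : ℝ) + 1 else 0 := by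
    intro μ z
    rw [cast_add_unitVec_apply]
    split_ifs <;> ring
  simp_rw [hdiff, mul_ite, mul_zero] at key
  have hite : ∀ μ, (∑' z, if μ = β then P μ ν z * (2 * (z β : ℝ) + 1) else (0 : ℝ))
      = if μ = β then ∑' z, P μ ν z * (2 * (z β : ℝ) + 1) else 0 := by
    intro μ; split_ifs <;> simp
  simp_rw [hite] at key
  rw [Finset.sum_ite_eq'] at key
  simp only [Finset.mem_univ, if_true] at key
  -- `key : Σ' z, P β ν z * (2 z_β + 1) = 0`; split it
  have s1 : Summable fun z => P β ν z * (z β : ℝ) := by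
    simpa only [pow_one] using momentSummable_mul_pow hP β ν β (k := 1) (by norm_num)
  have s0 : Summable fun z => P β ν z := by
    simpa only [pow_zero, mul_one] using momentSummable_mul_pow hP β ν β (k := 0) (by norm_num)
  have hsplit : ∑' z, P β ν z * (2 * (z β : ℝ) + 1) = 2 * ∑' z, P β ν z * (z β : ℝ) + ∑' z, P β ν z := by
    rw [← tsum_mul_left, ← Summable.tsum_add (s1.mul_left 2) s0]
    exact tsum_congr fun z => by ring
  rw [hsplit, tsum_eq_zero_of_ward hP hT β ν] at key
  linarith

/-- [folklore] **SECOND ONE-AXIS MOMENT.**  Ward (5.9) tested against `g(z) = z_β³` (`(z_β+1)³ − z_β³ = 3z_β² + 3z_β + 1`) together with the two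
lower moments gives `Σ_z P_{βν}(z)·z_β² = 0` for every `ν`. -/
theorem sqMoment_self_eq_zero_of_ward {P : B12Beta.Kernel d} (hP : MomentSummable P 3) (hT : WardTransversal P) (β ν : Fin d) :
    ∑' z, P β ν z * (z β : ℝ) ^ 2 = 0 := by
  have key := ward_pairing P hT ν (fun z => (z β : ℝ) ^ 3) (fun μ => momentSummable_mul_pow hP μ ν β le_rfl)
    (fun μ => momentSummable_mul_pow_shift hP μ ν β μ le_rfl)
  have hdiff : ∀ μ z, (((z + unitVec μ) β : ℤ) : ℝ) ^ 3 - (z β : ℝ) ^ 3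
      = if μ = β then 3 * (z β : ℝ) ^ 2 + 3 * (z β : ℝ) + 1 else 0 := by
    intro μ z
    rw [cast_add_unitVec_apply]
    split_ifs <;> ring
  simp_rw [hdiff, mul_ite, mul_zero] at key
  have hite : ∀ μ, (∑' z, if μ = β then P μ ν z * (3 * (z β : ℝ) ^ 2 + 3 * (z β : ℝ) + 1) else (0 : ℝ))
      = if μ = β then ∑' z, P μ ν z * (3 * (z β : ℝ) ^ 2 + 3 * (z β : ℝ) + 1) else 0 := by
    intro μ; split_ifs <;> simp
  simp_rw [hite] at key
  rw [Finset.sum_ite_eq'] at key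
  simp only [Finset.mem_univ, if_true] at key
  have s2 : Summable fun z => P β ν z * (z β : ℝ) ^ 2 := momentSummable_mul_pow hP β ν β (by norm_num)
  have s1 : Summable fun z => P β ν z * (z β : ℝ) := by
    simpa only [pow_one] using momentSummable_mul_pow hP β ν β (k := 1) (by norm_num)
  have s0 : Summable fun z => P β ν z := by
    simpa only [pow_zero, mul_one] using momentSummable_mul_pow hP β ν β (k := 0) (by norm_num)
  have hsplit : ∑' z, P β ν z * (3 * (z β : ℝ) ^ 2 + 3 * (z β : ℝ) + 1)
      = 3 * ∑' z, P β ν z * (z β : ℝ) ^ 2 + 3 * ∑' z, P β ν z * (z β : ℝ) + ∑' z, P β ν z := by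
    rw [← tsum_mul_left, ← tsum_mul_left, ← Summable.tsum_add (s2.mul_left 3) (s1.mul_left 3),
      ← Summable.tsum_add ((s2.mul_left 3).add (s1.mul_left 3)) s0]
    exact tsum_congr fun z => by ring
  rw [hsplit, firstMoment_self_eq_zero_of_ward hP hT β ν, tsum_eq_zero_of_ward hP hT β ν] at key
  linarith

/-- [folklore] **THE DIAGONAL ENTRY OF (1.22) VANISHES FOR A TRANSVERSE KERNEL**: `B12Beta.secondMoment P β β = Σ_z P_{ββ}(z)·z_β·z_β = 0`
([Balaban1987RG1] states (1.22) «for μ, ν arbitrary, μ ≠ ν» — this is the reason the diagonal carries no coefficient). -/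
theorem secondMoment_self_eq_zero_of_ward {P : B12Beta.Kernel d} (hP : MomentSummable P 3) (hT : WardTransversal P) (β : Fin d) :
    B12Beta.secondMoment P β β = 0 := by
  have e : B12Beta.secondMoment P β β = ∑' z, P β β z * (z β : ℝ) ^ 2 := by
    unfold B12Beta.secondMoment
    exact tsum_congr fun z => by ring
  rw [e]
  exact sqMoment_self_eq_zero_of_ward hP hT β β

/-- [folklore] **TWO TRANSVERSE KERNELS HAVE EQUAL (ZERO) DIAGONAL SECOND MOMENTS** — the `ℤ^d` form of the re-tabled road's «(μ,μ) control»: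
if the literal's kernel and the road's kernel are both Ward-transverse with summable third moments, `secondMoment P β β − secondMoment P′ β β = 0`. -/
theorem secondMoment_self_sub_eq_zero_of_ward {P P' : B12Beta.Kernel d} (hP : MomentSummable P 3) (hT : WardTransversal P)
    (hP' : MomentSummable P' 3) (hT' : WardTransversal P') (β : Fin d) :
    B12Beta.secondMoment P β β - B12Beta.secondMoment P' β β = 0 := by
  rw [secondMoment_self_eq_zero_of_ward hP hT β, secondMoment_self_eq_zero_of_ward hP' hT' β, sub_zero]

/-- [folklore] The same through an1∕an2's flip convention (RULING (R21): a `hessKer`-family `T` is read at `−z`): for the printed-variable kernel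
`fun μ ν z ↦ T μ ν (−z)` the hypotheses are stated flipped, and the diagonal second moment of `T` ITSELF vanishes too (`z_β·z_β` is even). -/
theorem secondMoment_self_eq_zero_of_ward_flip {T : B12Beta.Kernel d} (hP : MomentSummable (fun μ ν z => T μ ν (-z)) 3)
    (hT : WardTransversal (fun μ ν z => T μ ν (-z))) (β : Fin d) : B12Beta.secondMoment T β β = 0 := by
  have h := secondMoment_self_eq_zero_of_ward hP hT β
  have e : B12Beta.secondMoment (fun μ ν z => T μ ν (-z)) β β = B12Beta.secondMoment T β β := by
    unfold B12Beta.secondMoment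
    rw [← (Equiv.neg (Fin d → ℤ)).tsum_eq (fun z => T β β z * (z β : ℝ) * (z β : ℝ))]
    refine tsum_congr fun z => ?_
    simp only [Equiv.neg_apply, Pi.neg_apply, Int.cast_neg]
    ring
  rw [← e]; exact h

/-! ## §3 The diagonal-momentum form of (1.22): for a transverse, index-symmetric kernel `Σ_z P_{μν}(z)·(z_μ + z_ν)² = 2·secondMoment P μ ν`

WHY (located): the CAP lane reads the one-loop coefficient as the Ward-form curvature `c(p) = −F(p)∕((e^{−ip_μ} − 1)(e^{ip_ν} − 1))` along the DIAGONAL momentum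
`p = ε(e_μ + e_ν)` (cap1 `NORMALISATIONS` A5∕A7: `μ_m = lim_ε lim_n c_n(ε)`); at `O(ε²)` that direction pairs the kernel with `(z_μ + z_ν)² = z_μ² + 2z_μz_ν + z_ν²`, and the two
one-axis squares drop by §2 (the `z_ν²` one through the index symmetry (5.8) `P_{μν}(z) = P_{νμ}(−z)`), leaving exactly `2·Σ_z P_{μν} z_μ z_ν` — the dictionary between the
diagonal-momentum estimator and (1.22) is Ward + (5.8), nothing else. -/

/-- [folklore] The second-index one-axis square also drops, for an INDEX-SYMMETRIC transverse kernel: `Σ_z P_{μν}(z)·z_ν² = 0` ((5.8) `P_{μν}(z) = P_{νμ}(−z)` + §2 at `(ν, μ)`). -/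
theorem sqMoment_snd_eq_zero_of_ward {P : B12Beta.Kernel d} (hP : MomentSummable P 3) (hT : WardTransversal P) (hI : IndexSymmetric P)
    (μ ν : Fin d) : ∑' z, P μ ν z * (z ν : ℝ) ^ 2 = 0 := by
  have e : ∑' z, P μ ν z * (z ν : ℝ) ^ 2 = ∑' z, P ν μ z * (z ν : ℝ) ^ 2 := by
    rw [← (Equiv.neg (Fin d → ℤ)).tsum_eq (fun z => P ν μ z * (z ν : ℝ) ^ 2)]
    refine tsum_congr fun z => ?_
    rw [hI μ ν z]
    simp only [Equiv.neg_apply, Pi.neg_apply, Int.cast_neg]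
    ring
  rw [e]
  exact sqMoment_self_eq_zero_of_ward hP hT ν μ

/-- [folklore] **THE DIAGONAL-MOMENTUM FORM OF (1.22)**: for a Ward-transverse, index-symmetric kernel with summable third moments,
`Σ_z P_{μν}(z)·(z_μ + z_ν)² = 2·B12Beta.secondMoment P μ ν` (any `μ, ν`; at `μ = ν` both sides vanish by §2). -/
theorem tsum_mul_sq_add_eq_two_mul_secondMoment {P : B12Beta.Kernel d} (hP : MomentSummable P 3) (hT : WardTransversal P)
    (hI : IndexSymmetric P) (μ ν : Fin d) :
    ∑' z, P μ ν z * ((z μ : ℝ) + (z ν : ℝ)) ^ 2 = 2 * B12Beta.secondMoment P μ ν := by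
  have s2μ : Summable fun z => P μ ν z * (z μ : ℝ) ^ 2 := momentSummable_mul_pow hP μ ν μ (by norm_num)
  have s2ν : Summable fun z => P μ ν z * (z ν : ℝ) ^ 2 := momentSummable_mul_pow hP μ ν ν (by norm_num)
  have s11 : Summable fun z => P μ ν z * ((z μ : ℝ) * (z ν : ℝ)) :=
    hP.summable_mul μ ν 1 fun z => by
      rw [abs_mul, one_mul, pow_succ, pow_two]
      refine mul_le_mul ?_ (abs_apply_le_size z ν) (abs_nonneg _) (mul_nonneg (size_pos z).le (size_pos z).le)
      exact (abs_apply_le_size z μ).trans (by nlinarith [one_le_size z])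
  have e : B12Beta.secondMoment P μ ν = ∑' z, P μ ν z * ((z μ : ℝ) * (z ν : ℝ)) := by
    unfold B12Beta.secondMoment
    exact tsum_congr fun z => by ring
  calc ∑' z, P μ ν z * ((z μ : ℝ) + (z ν : ℝ)) ^ 2
      = ∑' z, (P μ ν z * (z μ : ℝ) ^ 2 + 2 * (P μ ν z * ((z μ : ℝ) * (z ν : ℝ))) + P μ ν z * (z ν : ℝ) ^ 2) :=
        tsum_congr fun z => by ring
    _ = ∑' z, P μ ν z * (z μ : ℝ) ^ 2 + 2 * ∑' z, P μ ν z * ((z μ : ℝ) * (z ν : ℝ)) + ∑' z, P μ ν z * (z ν : ℝ) ^ 2 := by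
        rw [Summable.tsum_add (s2μ.add (s11.mul_left 2)) s2ν, Summable.tsum_add s2μ (s11.mul_left 2), tsum_mul_left]
    _ = 2 * B12Beta.secondMoment P μ ν := by
        rw [sqMoment_self_eq_zero_of_ward hP hT μ ν, sqMoment_snd_eq_zero_of_ward hP hT hI μ ν, e]
        ring

/-! ## §4 The axis-swap law of a covariant, index-symmetric kernel (the identity a one-channel kernel `P_{μν}(·)` must satisfy on its own)

WHY (located): the row's by-value covariance test of an evaluated one-channel kernel (Q-an2-g55-1) reads the printed (1.21) `PermCovariant` at `σ = swap μ ν` through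
(5.8) `IndexSymmetric`: together they say `P_{μν}(z) = P_{μν}(−(z ∘ swap μ ν))` — a statement about ONE entry family `P_{μν}`, testable without the other channels. -/

/-- [folklore] **AXIS-SWAP LAW**: for a permutation-covariant ((1.21), `B12Beta.PermCovariant`) and index-symmetric ((5.8), `IndexSymmetric`) kernel,
`P_{μν}(z) = P_{μν}(−(z ∘ swap μ ν))`, i.e. `P_{μν}(z_μ, z_ν, z_⊥) = P_{μν}(−z_ν, −z_μ, −z_⊥)`. -/
theorem apply_eq_apply_neg_comp_swap {P : B12Beta.Kernel d} (hC : B12Beta.PermCovariant P) (hI : IndexSymmetric P) (μ ν : Fin d) (z : Fin d → ℤ) :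
    P μ ν z = P μ ν (-(z ∘ ⇑(Equiv.swap μ ν))) := by
  have h1 : P ν μ (z ∘ ⇑(Equiv.swap μ ν)) = P μ ν z := by
    have h := hC (Equiv.swap μ ν) μ ν z
    simpa only [Equiv.swap_apply_left, Equiv.swap_apply_right, Equiv.symm_swap] using h
  rw [← h1, hI ν μ]

end Summit.QuantumFields.BalabanUV.Beta.D1BFx.WardDiagonalSecondMoment
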